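import Summits.FinalStateConjecture.FinalStateConjecture.Theses.MergerLatticeBudget

/-!
# Route MergerLatticeBudget — negative lemma for the crux `LeafBudgetLawsR`
# (item stmt-FinalStateConjecture-14657, rev 7 = C″)

`LeafBudgetLawsR` is a conjunction whose first conjunct (clause (i)(a)) asserts, for EVERY admissible
datum, EVERY maximal vacuum Cauchy development with complete null infinity and EVERY compact
`C ⊆ J⁺(ιX)` meeting the visible region, the existence of a cut energy
`𝒟.HasCutBondiMass C m` — i.e. of an asymptotically round receding family of **smooth spacelike
2-spheres lying in the achronal boundary `∂J⁺(C)`**, each avoiding generator endpoints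
(`RoundSectionFamily`, `CutBondiMass.lean`), with convergent Hawking masses.

Paper theorem (EVIDENCE.md of refuter-rattack-stmt-FinalStateConjecture-14657-0, witness W1): if `C` is a
short spacelike geodesic SEGMENT (compact, late, visible), then `RoundSectionFamily 𝒟 C` is EMPTY in
every smooth globally hyperbolic development: every smooth closed spacelike section of `∂J⁺(C)`
avoiding endpoints meets every generator (covering argument), in particular the junction generators
issuing from the two endpoints orthogonally to the segment, along which `∂J⁺(C)` is the `C¹`-but-not-`C²`
union of two null sheets whose null second fundamental forms differ by a non-zero rank-one form; a
`C²` spacelike surface through such a point would have tangent plane in the kernel of that form, a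
null 2-plane — contradiction. Hence clause (i)(a) fails at `C`, in every development.

This file lands the kernel-checked part: `H → ¬ LeafBudgetLawsR`, where
`H = ConeIrregularLateSetExists` packages the paper witness (some admissible MGHD with complete null
infinity carries a late compact set with no cut energy). `H` is not constructible in the tree today
(it needs an MGHD with complete `𝓘⁺` as a `VacuumCauchyDevelopment`, plus the differential geometry
of achronal boundaries), so this is a NEGATIVE LEMMA MODULO `H`, not a refutation.
-/

noncomputable section

namespace Summit.FinalStateConjecture.FinalStateConjecture.Theorems.LeafBudgetLawsR.Negative

open Literature.Geometry.Lorentzian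
open Summit.FinalStateConjecture.FinalStateConjecture.Theses.MergerLatticeBudget
open Set
open scoped Manifold ContDiff Topology

/-- Clause (i)(a) of `LeafBudgetLawsR`, extracted: every late compact set of every admissible maximal
development with complete null infinity has a cut energy. [folklore] -/
theorem exists_cutMass_of_leafBudgetLawsR (h : LeafBudgetLawsR) (X : Type) [TopologicalSpace X]
    [ChartedSpace E3 X] [IsManifold (𝓡 3) ((⊤ : ℕ∞) : WithTop ℕ∞) X] [T2Space X]
    [SecondCountableTopology X] [ConnectedSpace X] (D : InitialDataSet (𝓡 3) X)
    (hD : D ∈ admissibleVacuumData X) (𝒟 : VacuumCauchyDevelopment D) (hmax : 𝒟.IsMaximal)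
    (hscri : Summit.FinalStateConjecture.HasCompleteNullInfinity 𝒟.toCauchyDevelopment)
    [𝒟.metric.HasLeviCivita] (C : Set 𝒟.carrier) (hC : IsCompact C)
    (hvis : (C ∩ 𝒟.toCauchyDevelopment.toDataEmbedding.visibleRegion).Nonempty)
    (hfut : C ⊆ 𝒟.metric.causalFuture 𝒟.timeOrientation (Set.range 𝒟.embed)) :
    ∃ m : ℝ, 𝒟.toCauchyDevelopment.HasCutBondiMass C m := by
  have h1 := h X D hD 𝒟 hmax hscri
  exact h1.1 C ⟨hC, hvis, hfut⟩

/-- **`LeafBudgetLawsR` is false as soon as one late compact set has no cut energy** (binder form of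
the negative lemma; the hypotheses are exactly the fields of `ConeIrregularLateSetExists`). On paper
they are met in every admissible maximal development with complete null infinity by a short spacelike
geodesic segment `C` (EVIDENCE.md, W1). [folklore] -/
theorem leafBudgetLawsR_false_of_lateSet_without_cutMass (X : Type) [TopologicalSpace X]
    [ChartedSpace E3 X] [IsManifold (𝓡 3) ((⊤ : ℕ∞) : WithTop ℕ∞) X] [T2Space X]
    [SecondCountableTopology X] [ConnectedSpace X] (D : InitialDataSet (𝓡 3) X)
    (hD : D ∈ admissibleVacuumData X) (𝒟 : VacuumCauchyDevelopment D) (hmax : 𝒟.IsMaximal)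
    (hscri : Summit.FinalStateConjecture.HasCompleteNullInfinity 𝒟.toCauchyDevelopment)
    [𝒟.metric.HasLeviCivita] (C : Set 𝒟.carrier) (hC : IsCompact C)
    (hvis : (C ∩ 𝒟.toCauchyDevelopment.toDataEmbedding.visibleRegion).Nonempty)
    (hfut : C ⊆ 𝒟.metric.causalFuture 𝒟.timeOrientation (Set.range 𝒟.embed))
    (hno : ∀ m : ℝ, ¬ 𝒟.toCauchyDevelopment.HasCutBondiMass C m) : ¬ LeafBudgetLawsR := fun h ↦ by
  obtain ⟨m, hm⟩ := exists_cutMass_of_leafBudgetLawsR h X D hD 𝒟 hmax hscri C hC hvis hfut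
  exact hno m hm

/-- Hypothesis `H` of the negative lemma: **some admissible datum has a maximal vacuum Cauchy
development with complete null infinity containing a late compact set without any cut energy** — a
compact `C ⊆ J⁺(ιX)` meeting the visible region such that no asymptotically round receding family of
smooth spacelike spheres in `∂J⁺(C)` has a Hawking-mass limit (`¬ HasCutBondiMass C m` for all `m`).
On paper this holds in EVERY such development with `C` a short spacelike geodesic segment
(EVIDENCE.md, W1: the round-section carrier is empty on the cone of a segment); in particular for
the Minkowski development of trivial data on `ℝ³`. [topic Geometry/Lorentzian/CutBondiMass] -/
def ConeIrregularLateSetExists : Prop :=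
  ∃ (X : Type) (_ : TopologicalSpace X) (_ : ChartedSpace E3 X)
    (_ : IsManifold (𝓡 3) ((⊤ : ℕ∞) : WithTop ℕ∞) X) (_ : T2Space X) (_ : SecondCountableTopology X)
    (_ : ConnectedSpace X) (D : InitialDataSet (𝓡 3) X) (_ : D ∈ admissibleVacuumData X)
    (𝒟 : VacuumCauchyDevelopment D) (_ : 𝒟.IsMaximal)
    (_ : Summit.FinalStateConjecture.HasCompleteNullInfinity 𝒟.toCauchyDevelopment)
    (_ : 𝒟.metric.HasLeviCivita) (C : Set 𝒟.carrier),
    IsCompact C ∧ (C ∩ 𝒟.toCauchyDevelopment.toDataEmbedding.visibleRegion).Nonempty ∧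
      C ⊆ 𝒟.metric.causalFuture 𝒟.timeOrientation (Set.range 𝒟.embed) ∧
      ∀ m : ℝ, ¬ 𝒟.toCauchyDevelopment.HasCutBondiMass C m

/-- **Negative lemma modulo `ConeIrregularLateSetExists`**: a single late compact set without cut
energy, in a single admissible maximal development with complete null infinity, falsifies
`LeafBudgetLawsR` (its clause (i)(a) quantifies over all compact late sets). [folklore] -/
theorem leafBudgetLawsR_false_of_coneIrregularLateSetExists (H : ConeIrregularLateSetExists) :
    ¬ LeafBudgetLawsR := by
  intro h
  obtain ⟨X, _, _, _, _, _, _, D, hD, 𝒟, hmax, hscri, _, C, hC, hvis, hfut, hno⟩ := H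
  obtain ⟨m, hm⟩ := exists_cutMass_of_leafBudgetLawsR h X D hD 𝒟 hmax hscri C hC hvis hfut
  exact hno m hm

end Summit.FinalStateConjecture.FinalStateConjecture.Theorems.LeafBudgetLawsR.Negative

end
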